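import Mathlib.MeasureTheory.Integral.DominatedConvergence
import Mathlib.MeasureTheory.Measure.Prod
import Mathlib.MeasureTheory.Function.L2Space
import Mathlib.Topology.Algebra.InfiniteSum.NatInt
import Mathlib.Analysis.SpecificLimits.Basic
import Literature.Barriers.AtomisticToContinuum.AnticontinuumLocalizationDynamics
import HarnessLib

/-!
# The `L²` estimates in the proof of De Roeck–Huveneers' Theorem 2 (support file)

Second support file for `Literature/Barriers/AtomisticToContinuum/AnticontinuumLocalization.lean`,
formalising the elementary analysis of the printed proof of Theorem 2
[cite: DeRoeckHuveneers2015, §7 proof of Thm 2]. Everything here is PROVED: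

* `RotorChain.sq_intervalIntegral_le` : `(∫₀^τ g)² ≤ τ∫₀^τ g²` (Jensen / Cauchy–Schwarz in time).
* `RotorChain.lintegral_sq_timeAverage_le` : the abstract mechanism — if `μ` is stationary for the
  maps `Φ_s` on angle-periodic observables and
  `ε∫₀^τ J(Φ_s z) ds = 𝒰(Φ_τ z) - 𝒰(z) + κ∫₀^τ 𝒢(Φ_s z) ds`, then
  `∫ (ετ^{-1/2}∫₀^τ J(Φ_s z) ds)² dμ ≤ (3/τ)(2∫𝒰² dμ + κ²τ²∫𝒢² dμ)` (Tonelli + stationarity).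
* `RotorChain.IsFlow.integral_totalCurrent_eq` : integrating Theorem 1's decomposition
  `εJ_{a,a+1} = L_H U_a + κ G_a` along the flow and over the bonds gives exactly that identity for
  `J = 𝒥_N`, `𝒰 = N^{-1/2}∑U_a`, `𝒢 = N^{-1/2}∑G_a`.
* the summations `RotorChain.integral_sq_sum_le`, `RotorChain.gradSqNorm_le` (Dirichlet form
  `⟨|∇f|²⟩ = ∑_x (⟨(∂_{q_x}f)²⟩ + ⟨(∂_{ω_x}f)²⟩)` of a local function), `RotorChain.sum_abs_cov_le` and
  `RotorChain.sum_exp_neg_mul_abs_le` (`∑_{x ∈ ℤ_N} e^{-c|x-a|} ≤ ∑_{k ∈ ℤ} e^{-c|k|}`) turning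
  exponentially decaying covariance bounds for local functions into `⟨(∑ₐ fₐ)²⟩ ≤ N · K` with `K`
  uniform in `N`.

No definitions (theorem-only support file).
-/

noncomputable section

open MeasureTheory Filter Topology Set
open scoped ContDiff ENNReal

namespace Literature.Barriers.AtomisticToContinuum.HeatConduction.RotorChain

open Literature.MathematicalPhysics.KineticTheory.HeatConduction

/-- Cauchy–Schwarz in time: `(∫₀^τ g)² ≤ τ ∫₀^τ g²` for continuous `g` and `τ ≥ 0`. [folklore] -/
theorem sq_intervalIntegral_le {g : ℝ → ℝ} (hg : Continuous g) {τ : ℝ} (hτ : 0 ≤ τ) :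
    (∫ s in (0:ℝ)..τ, g s) ^ 2 ≤ τ * ∫ s in (0:ℝ)..τ, g s ^ 2 := by
  rcases hτ.eq_or_lt with h | hτ'
  · subst h; simp
  set I := ∫ s in (0:ℝ)..τ, g s with hI
  set Q := ∫ s in (0:ℝ)..τ, g s ^ 2 with hQ
  have h0 : 0 ≤ ∫ s in (0:ℝ)..τ, (g s - I / τ) ^ 2 :=
    intervalIntegral.integral_nonneg hτ fun s _ => sq_nonneg _
  have hi1 : IntervalIntegrable (fun s => g s ^ 2) volume 0 τ := (hg.pow 2).intervalIntegrable _ _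
  have hi2 : IntervalIntegrable (fun s => 2 * (I / τ) * g s) volume 0 τ :=
    (continuous_const.mul hg).intervalIntegrable _ _
  have hi3 : IntervalIntegrable (fun _ : ℝ => (I / τ) ^ 2) volume 0 τ :=
    continuous_const.intervalIntegrable _ _
  have h1 : ∫ s in (0:ℝ)..τ, (g s - I / τ) ^ 2 = Q - 2 * (I / τ) * I + (I / τ) ^ 2 * τ := by
    have e : (fun s => (g s - I / τ) ^ 2) = fun s => (g s ^ 2 - 2 * (I / τ) * g s) + (I / τ) ^ 2 := by
      funext s; ring
    rw [e, intervalIntegral.integral_add (hi1.sub hi2) hi3, intervalIntegral.integral_sub hi1 hi2,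
      intervalIntegral.integral_const_mul, intervalIntegral.integral_const]
    simp only [sub_zero, smul_eq_mul]
    ring
  rw [h1] at h0
  have h2 : 0 ≤ τ * Q - I ^ 2 := by
    have : Q - 2 * (I / τ) * I + (I / τ) ^ 2 * τ = (τ * Q - I ^ 2) / τ := by
      field_simp
      ring
    rw [this] at h0
    exact (div_nonneg_iff.1 h0).elim (fun h => h.1) fun h => absurd h.2 (not_le.2 hτ')
  linarith

/-- Elementary inequality `(A - B + C)² ≤ 3(A² + B² + C²)`. [folklore] -/
theorem sq_sub_add_le_three (A B C : ℝ) : (A - B + C) ^ 2 ≤ 3 * (A ^ 2 + B ^ 2 + C ^ 2) := by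
  nlinarith [sq_nonneg (A + B), sq_nonneg (A - C), sq_nonneg (B + C)]

variable {N : ℕ}

/-- **The `L²` mechanism of the proof of Theorem 2** (abstract form). Let `μ` be a measure on the
lifted phase space which is stationary for the maps `Φ_s` on angle-periodic observables, and let
`J, 𝒰, 𝒢` be continuous, `𝒰, 𝒢` angle-periodic with `𝒰², 𝒢² ∈ L¹(μ)`, related along `Φ` by the
"coboundary plus remainder" identity `ε ∫₀^τ J(Φ_s z) ds = 𝒰(Φ_τ z) - 𝒰(z) + κ ∫₀^τ 𝒢(Φ_s z) ds`.
Then `∫ (ε τ^{-1/2} ∫₀^τ J(Φ_s z) ds)² dμ ≤ (3/τ)(2 ∫𝒰² dμ + κ² τ² ∫𝒢² dμ)` (stationarity for the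
`𝒰`-terms; Cauchy–Schwarz in time, Tonelli and stationarity for the `𝒢`-term).
[cite: DeRoeckHuveneers2015, §7 proof of Thm 2] -/
theorem lintegral_sq_timeAverage_le (μ : Measure (PhaseSpace N)) [SFinite μ]
    {Φ : ℝ → PhaseSpace N → PhaseSpace N} (hΦ : Continuous fun p : ℝ × PhaseSpace N => Φ p.1 p.2)
    (hinv : ∀ F : PhaseSpace N → ℝ≥0∞, Measurable F →
      (∀ (z : PhaseSpace N) (x : Fin N), F (Function.update z.1 x (z.1 x + 2 * Real.pi), z.2) = F z) →
      ∀ s : ℝ, ∫⁻ z, F (Φ s z) ∂μ = ∫⁻ z, F z ∂μ)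
    {J 𝒰 𝒢 : PhaseSpace N → ℝ} (h𝒰 : Continuous 𝒰) (h𝒢 : Continuous 𝒢)
    (h𝒰p : IsAnglePeriodic N 𝒰) (h𝒢p : IsAnglePeriodic N 𝒢)
    (h𝒰i : Integrable (fun z => 𝒰 z ^ 2) μ) (h𝒢i : Integrable (fun z => 𝒢 z ^ 2) μ)
    {ε κ τ : ℝ} (hτ : 0 < τ)
    (hid : ∀ z, ε * ∫ s in (0:ℝ)..τ, J (Φ s z) =
      𝒰 (Φ τ z) - 𝒰 z + κ * ∫ s in (0:ℝ)..τ, 𝒢 (Φ s z)) :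
    ∫⁻ z, ENNReal.ofReal ((ε / Real.sqrt τ * ∫ s in (0:ℝ)..τ, J (Φ s z)) ^ 2) ∂μ ≤
      ENNReal.ofReal (3 / τ * (2 * ∫ z, 𝒰 z ^ 2 ∂μ + κ ^ 2 * τ ^ 2 * ∫ z, 𝒢 z ^ 2 ∂μ)) := by
  have hcurve : ∀ z, Continuous fun s : ℝ => Φ s z := fun z =>
    hΦ.comp (continuous_id.prodMk continuous_const)
  have hmapτ : ∀ s, Continuous (Φ s) := fun s => hΦ.comp (continuous_const.prodMk continuous_id)
  -- pointwise bound
  have hpt : ∀ z, (ε / Real.sqrt τ * ∫ s in (0:ℝ)..τ, J (Φ s z)) ^ 2 ≤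
      3 / τ * (𝒰 (Φ τ z) ^ 2 + 𝒰 z ^ 2 + κ ^ 2 * τ * ∫ s in (0:ℝ)..τ, 𝒢 (Φ s z) ^ 2) := by
    intro z
    have hcs := sq_intervalIntegral_le (h𝒢.comp (hcurve z)) hτ.le
    have e1 : (ε / Real.sqrt τ * ∫ s in (0:ℝ)..τ, J (Φ s z)) ^ 2 =
        (ε * ∫ s in (0:ℝ)..τ, J (Φ s z)) ^ 2 / τ := by
      rw [div_mul_eq_mul_div, div_pow, Real.sq_sqrt hτ.le]
    rw [e1, hid z, mul_comm (3 / τ), ← mul_div_assoc, div_le_div_iff_of_pos_right hτ]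
    refine (sq_sub_add_le_three _ _ _).trans ?_
    rw [mul_comm _ (3 : ℝ)]
    refine mul_le_mul_of_nonneg_left ?_ (by norm_num)
    simp only [Function.comp_def] at hcs
    rw [mul_pow, mul_assoc]
    gcongr
  -- measurability
  have hm1 : Measurable fun z => ENNReal.ofReal (𝒰 (Φ τ z) ^ 2) :=
    (((h𝒰.comp (hmapτ τ)).pow 2).measurable).ennreal_ofReal
  have hm2 : Measurable fun z => ENNReal.ofReal (𝒰 z ^ 2) := ((h𝒰.pow 2).measurable).ennreal_ofReal
  have hm12 : Measurable fun z => ENNReal.ofReal (𝒰 (Φ τ z) ^ 2) + ENNReal.ofReal (𝒰 z ^ 2) :=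
    Measurable.add hm1 hm2
  have hjoint : Continuous fun p : PhaseSpace N × ℝ => 𝒢 (Φ p.2 p.1) ^ 2 :=
    (h𝒢.comp (hΦ.comp (continuous_snd.prodMk continuous_fst))).pow 2
  have hm3 : Continuous fun z => ∫ s in (0:ℝ)..τ, 𝒢 (Φ s z) ^ 2 :=
    intervalIntegral.continuous_parametric_intervalIntegral_of_continuous' hjoint 0 τ
  -- stationarity for the `𝒰`-term
  have hU : ∫⁻ z, ENNReal.ofReal (𝒰 (Φ τ z) ^ 2) ∂μ = ∫⁻ z, ENNReal.ofReal (𝒰 z ^ 2) ∂μ :=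
    hinv (fun z => ENNReal.ofReal (𝒰 z ^ 2)) hm2 (fun z x => by rw [h𝒰p z x]) τ
  -- Tonelli and stationarity for the `𝒢`-term
  have hG : ∫⁻ z, ENNReal.ofReal (∫ s in (0:ℝ)..τ, 𝒢 (Φ s z) ^ 2) ∂μ =
      ENNReal.ofReal τ * ∫⁻ z, ENNReal.ofReal (𝒢 z ^ 2) ∂μ := by
    have e : ∀ z, ENNReal.ofReal (∫ s in (0:ℝ)..τ, 𝒢 (Φ s z) ^ 2) =
        ∫⁻ s in Ioc 0 τ, ENNReal.ofReal (𝒢 (Φ s z) ^ 2) := fun z => by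
      rw [intervalIntegral.integral_of_le hτ.le, ← ofReal_integral_eq_lintegral_ofReal]
      · exact ((h𝒢.comp (hcurve z)).pow 2).integrableOn_Ioc
      · exact ae_of_all _ fun s => sq_nonneg _
    simp_rw [e]
    have hae : AEMeasurable (Function.uncurry fun (z : PhaseSpace N) (s : ℝ) =>
        ENNReal.ofReal (𝒢 (Φ s z) ^ 2)) (μ.prod (volume.restrict (Ioc 0 τ))) :=
      (hjoint.measurable.ennreal_ofReal).aemeasurable
    rw [lintegral_lintegral_swap hae]
    have e2 : ∀ s, ∫⁻ z, ENNReal.ofReal (𝒢 (Φ s z) ^ 2) ∂μ = ∫⁻ z, ENNReal.ofReal (𝒢 z ^ 2) ∂μ :=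
      fun s => hinv (fun z => ENNReal.ofReal (𝒢 z ^ 2)) ((h𝒢.pow 2).measurable.ennreal_ofReal)
        (fun z x => by rw [h𝒢p z x]) s
    simp_rw [e2]
    rw [setLIntegral_const, Real.volume_Ioc, sub_zero, mul_comm]
  -- integrals of squares as real numbers
  have hU' : ∫⁻ z, ENNReal.ofReal (𝒰 z ^ 2) ∂μ = ENNReal.ofReal (∫ z, 𝒰 z ^ 2 ∂μ) :=
    (ofReal_integral_eq_lintegral_ofReal h𝒰i (ae_of_all _ fun z => sq_nonneg _)).symm
  have hG' : ∫⁻ z, ENNReal.ofReal (𝒢 z ^ 2) ∂μ = ENNReal.ofReal (∫ z, 𝒢 z ^ 2 ∂μ) :=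
    (ofReal_integral_eq_lintegral_ofReal h𝒢i (ae_of_all _ fun z => sq_nonneg _)).symm
  have haU : 0 ≤ ∫ z, 𝒰 z ^ 2 ∂μ := integral_nonneg fun z => sq_nonneg _
  have haG : 0 ≤ ∫ z, 𝒢 z ^ 2 ∂μ := integral_nonneg fun z => sq_nonneg _
  calc ∫⁻ z, ENNReal.ofReal ((ε / Real.sqrt τ * ∫ s in (0:ℝ)..τ, J (Φ s z)) ^ 2) ∂μ
      ≤ ∫⁻ z, ENNReal.ofReal (3 / τ * (𝒰 (Φ τ z) ^ 2 + 𝒰 z ^ 2 +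
          κ ^ 2 * τ * ∫ s in (0:ℝ)..τ, 𝒢 (Φ s z) ^ 2)) ∂μ :=
        lintegral_mono fun z => ENNReal.ofReal_le_ofReal (hpt z)
    _ = ENNReal.ofReal (3 / τ) * (∫⁻ z, ENNReal.ofReal (𝒰 (Φ τ z) ^ 2) ∂μ +
          ∫⁻ z, ENNReal.ofReal (𝒰 z ^ 2) ∂μ +
          ENNReal.ofReal (κ ^ 2 * τ) * ∫⁻ z, ENNReal.ofReal (∫ s in (0:ℝ)..τ, 𝒢 (Φ s z) ^ 2) ∂μ) := by
        have e : ∀ z, ENNReal.ofReal (3 / τ * (𝒰 (Φ τ z) ^ 2 + 𝒰 z ^ 2 +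
            κ ^ 2 * τ * ∫ s in (0:ℝ)..τ, 𝒢 (Φ s z) ^ 2)) =
            ENNReal.ofReal (3 / τ) * (ENNReal.ofReal (𝒰 (Φ τ z) ^ 2) + ENNReal.ofReal (𝒰 z ^ 2) +
              ENNReal.ofReal (κ ^ 2 * τ) * ENNReal.ofReal (∫ s in (0:ℝ)..τ, 𝒢 (Φ s z) ^ 2)) := by
          intro z
          have h3 : 0 ≤ ∫ s in (0:ℝ)..τ, 𝒢 (Φ s z) ^ 2 :=
            intervalIntegral.integral_nonneg hτ.le fun s _ => sq_nonneg _
          rw [ENNReal.ofReal_mul (by positivity), ENNReal.ofReal_add (by positivity) (by positivity),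
            ENNReal.ofReal_add (by positivity) (by positivity), ENNReal.ofReal_mul (by positivity)]
        simp_rw [e]
        rw [lintegral_const_mul' _ _ ENNReal.ofReal_ne_top, lintegral_add_left hm12,
          lintegral_add_left hm1, lintegral_const_mul' _ _ ENNReal.ofReal_ne_top]
    _ = ENNReal.ofReal (3 / τ) * (ENNReal.ofReal (∫ z, 𝒰 z ^ 2 ∂μ) + ENNReal.ofReal (∫ z, 𝒰 z ^ 2 ∂μ) +
          ENNReal.ofReal (κ ^ 2 * τ) * (ENNReal.ofReal τ * ENNReal.ofReal (∫ z, 𝒢 z ^ 2 ∂μ))) := by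
        rw [hU, hG, hU', hG']
    _ = ENNReal.ofReal (3 / τ * (2 * ∫ z, 𝒰 z ^ 2 ∂μ + κ ^ 2 * τ ^ 2 * ∫ z, 𝒢 z ^ 2 ∂μ)) := by
        have e : 3 / τ * (2 * ∫ z, 𝒰 z ^ 2 ∂μ + κ ^ 2 * τ ^ 2 * ∫ z, 𝒢 z ^ 2 ∂μ) =
            3 / τ * ((∫ z, 𝒰 z ^ 2 ∂μ) + (∫ z, 𝒰 z ^ 2 ∂μ) +
              κ ^ 2 * τ * (τ * ∫ z, 𝒢 z ^ 2 ∂μ)) := by ring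
        rw [e, ENNReal.ofReal_mul (p := 3 / τ) (by positivity),
          ENNReal.ofReal_add (by positivity) (by positivity),
          ENNReal.ofReal_add haU haU, ENNReal.ofReal_mul (p := κ ^ 2 * τ) (by positivity),
          ENNReal.ofReal_mul (p := τ) hτ.le]

/-! ### Summing the decorrelation bounds -/

/-- `∫ (∑ₐ fₐ)² dμ ≤ ∑ₐ ∑_b B a b` whenever `∫ fₐ f_b dμ ≤ B a b` and the `fₐ` are in `L²(μ)`.
[folklore] -/
theorem integral_sq_sum_le {X : Type*} [MeasurableSpace X] (μ : Measure X) {ι : Type*} [Fintype ι]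
    (f : ι → X → ℝ) (hf : ∀ a, MemLp (f a) 2 μ) (B : ι → ι → ℝ)
    (hB : ∀ a b, ∫ z, f a z * f b z ∂μ ≤ B a b) :
    ∫ z, (∑ a, f a z) ^ 2 ∂μ ≤ ∑ a, ∑ b, B a b := by
  have hint : ∀ a b, Integrable (fun z => f a z * f b z) μ := fun a b =>
    (hf a).integrable_mul (hf b)
  have e : ∀ z, (∑ a, f a z) ^ 2 = ∑ a, ∑ b, f a z * f b z := fun z => by
    rw [sq, Finset.sum_mul_sum]
  simp_rw [e]
  rw [integral_finsetSum _ (fun a _ => integrable_finsetSum _ (fun b _ => hint a b))]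
  refine Finset.sum_le_sum fun a _ => ?_
  rw [integral_finsetSum _ (fun b _ => hint a b)]
  exact Finset.sum_le_sum fun b _ => hB a b

/-- Summability of `k ↦ e^{-c|k|}` over `ℤ` for `c > 0`. [folklore] -/
theorem summable_exp_neg_mul_abs {c : ℝ} (hc : 0 < c) :
    Summable fun k : ℤ => Real.exp (-c * |(k : ℝ)|) := by
  have hr0 : 0 ≤ Real.exp (-c) := (Real.exp_pos _).le
  have hr1 : Real.exp (-c) < 1 := Real.exp_lt_one_iff.2 (by linarith)
  have hgeo := summable_geometric_of_lt_one hr0 hr1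
  have e : ∀ n : ℕ, Real.exp (-c * (n : ℝ)) = Real.exp (-c) ^ n := fun n => by
    rw [← Real.exp_nat_mul, mul_comm]
  refine Summable.of_nat_of_neg ?_ ?_
  · refine hgeo.congr fun n => ?_
    simp only [Int.cast_natCast, Nat.abs_cast, e]
  · refine hgeo.congr fun n => ?_
    simp only [Int.cast_neg, Int.cast_natCast, abs_neg, Nat.abs_cast, e]

/-- `∑_{x ∈ ℤ_N} e^{-c|x - a|} ≤ S(c)` uniformly in `N` and `a`. [folklore] -/
theorem sum_exp_neg_mul_abs_le {c : ℝ} (hc : 0 < c) (N : ℕ) (a : Fin N) :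
    ∑ x : Fin N, Real.exp (-c * |(x.val : ℝ) - a.val|) ≤ ∑' k : ℤ, Real.exp (-c * |(k : ℝ)|) := by
  classical
  set g : ℤ → ℝ := fun k => Real.exp (-c * |(k : ℝ)|) with hg
  set ι : Fin N → ℤ := fun x => (x.val : ℤ) - a.val with hι
  have hinj : ∀ x ∈ (Finset.univ : Finset (Fin N)), ∀ y ∈ (Finset.univ : Finset (Fin N)),
      ι x = ι y → x = y := by
    intro x _ y _ h
    simp only [hι] at h
    exact Fin.ext (by omega)
  have e : ∑ x : Fin N, Real.exp (-c * |(x.val : ℝ) - a.val|) = ∑ k ∈ Finset.univ.image ι, g k := by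
    rw [Finset.sum_image hinj]
    refine Finset.sum_congr rfl fun x _ => ?_
    simp [hg, hι]
  rw [e]
  exact (summable_exp_neg_mul_abs hc).sum_le_tsum _ fun k _ => (Real.exp_pos _).le

/-- A local function with bounded partial Dirichlet energies has `⟨|∇f|²⟩ ≤ e^{cC} S(c) · 2β`
(the indicator of the dependence window `|x - a| ≤ C` is dominated by `e^{c(C - |x - a|)}`).
[folklore] -/
theorem gradSqNorm_le (μ : Measure (PhaseSpace N)) {f : PhaseSpace N → ℝ} {a : Fin N} {C β c : ℝ}
    (hβ : 0 ≤ β) (hc : 0 < c) (hloc : DependsOnlyNear N a C f)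
    (hbd : ∀ x, ∫ z, partialQ x f z ^ 2 ∂μ ≤ β ∧ ∫ z, partialP x f z ^ 2 ∂μ ≤ β) :
    ∑ x : Fin N, (∫ z, partialQ x f z ^ 2 ∂μ + ∫ z, partialP x f z ^ 2 ∂μ) ≤
      Real.exp (c * C) * (∑' k : ℤ, Real.exp (-c * |(k : ℝ)|)) * (2 * β) := by
  have hx : ∀ x : Fin N, (∫ z, partialQ x f z ^ 2 ∂μ + ∫ z, partialP x f z ^ 2 ∂μ) ≤
      Real.exp (c * C) * (2 * β) * Real.exp (-c * |(x.val : ℝ) - a.val|) := by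
    intro x
    by_cases h : |(x.val : ℝ) - a.val| ≤ C
    · calc (∫ z, partialQ x f z ^ 2 ∂μ + ∫ z, partialP x f z ^ 2 ∂μ) ≤ 2 * β := by
            linarith [(hbd x).1, (hbd x).2]
        _ = 1 * (2 * β) * 1 := by ring
        _ ≤ (Real.exp (c * C) * Real.exp (-c * |(x.val : ℝ) - a.val|)) * (2 * β) * 1 := by
            gcongr
            rw [← Real.exp_add]
            exact Real.one_le_exp (by nlinarith)
        _ = Real.exp (c * C) * (2 * β) * Real.exp (-c * |(x.val : ℝ) - a.val|) := by ring
    · rw [not_le] at h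
      have h1 : ∫ z, partialQ x f z ^ 2 ∂μ = 0 := by
        simp [hloc.partialQ_eq_zero h]
      have h2 : ∫ z, partialP x f z ^ 2 ∂μ = 0 := by
        simp [hloc.partialP_eq_zero h]
      rw [h1, h2, add_zero]
      positivity
  calc ∑ x : Fin N, (∫ z, partialQ x f z ^ 2 ∂μ + ∫ z, partialP x f z ^ 2 ∂μ)
      ≤ ∑ x : Fin N, Real.exp (c * C) * (2 * β) * Real.exp (-c * |(x.val : ℝ) - a.val|) :=
        Finset.sum_le_sum fun x _ => hx x
    _ = Real.exp (c * C) * (2 * β) * ∑ x : Fin N, Real.exp (-c * |(x.val : ℝ) - a.val|) := by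
        rw [Finset.mul_sum]
    _ ≤ Real.exp (c * C) * (2 * β) * ∑' k : ℤ, Real.exp (-c * |(k : ℝ)|) := by
        gcongr
        exact sum_exp_neg_mul_abs_le hc N a
    _ = Real.exp (c * C) * (∑' k : ℤ, Real.exp (-c * |(k : ℝ)|)) * (2 * β) := by ring

/-- Summing exponentially decaying covariance bounds: if
`|⟨fₐ f_b⟩| ≤ C_d e^{-c(|a - b| - 2C)} Dₐ^{1/2} D_b^{1/2}` with `0 ≤ Dₐ ≤ D` for all `a, b ∈ ℤ_N` (in
the application `Dₐ = ⟨|∇fₐ|²⟩`), then `∑ₐ ∑_b |⟨fₐ f_b⟩| ≤ N · C_d e^{2cC} D S(c)` with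
`S(c) = ∑_{k ∈ ℤ} e^{-c|k|}`. [folklore] -/
theorem sum_abs_cov_le (μ : Measure (PhaseSpace N)) (f : Fin N → PhaseSpace N → ℝ)
    (Df : Fin N → ℝ) {Cd c C D : ℝ} (hCd : 0 ≤ Cd) (hc : 0 < c) (hD : 0 ≤ D)
    (hcov : ∀ a b : Fin N, |∫ z, f a z * f b z ∂μ| ≤
      Cd * Real.exp (-c * (|(a.val : ℝ) - b.val| - C - C)) * Real.sqrt (Df a) * Real.sqrt (Df b))
    (hgrad : ∀ a, Df a ≤ D) :
    ∑ a, ∑ b, |∫ z, f a z * f b z ∂μ| ≤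
      N * (Cd * Real.exp (2 * c * C) * D * ∑' k : ℤ, Real.exp (-c * |(k : ℝ)|)) := by
  have hab : ∀ a b : Fin N, |∫ z, f a z * f b z ∂μ| ≤
      Cd * Real.exp (2 * c * C) * D * Real.exp (-c * |(b.val : ℝ) - a.val|) := by
    intro a b
    refine (hcov a b).trans ?_
    have hs : Real.sqrt (Df a) * Real.sqrt (Df b) ≤ D := by
      calc Real.sqrt (Df a) * Real.sqrt (Df b)
          ≤ Real.sqrt D * Real.sqrt D :=
            mul_le_mul (Real.sqrt_le_sqrt (hgrad a)) (Real.sqrt_le_sqrt (hgrad b))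
              (Real.sqrt_nonneg _) (Real.sqrt_nonneg _)
        _ = D := Real.mul_self_sqrt hD
    have he : Real.exp (-c * (|(a.val : ℝ) - b.val| - C - C)) =
        Real.exp (2 * c * C) * Real.exp (-c * |(b.val : ℝ) - a.val|) := by
      rw [← Real.exp_add, abs_sub_comm]
      ring_nf
    rw [he, mul_assoc (Cd * _)]
    calc Cd * (Real.exp (2 * c * C) * Real.exp (-c * |(b.val : ℝ) - a.val|)) *
          (Real.sqrt (Df a) * Real.sqrt (Df b))
        ≤ Cd * (Real.exp (2 * c * C) * Real.exp (-c * |(b.val : ℝ) - a.val|)) * D := by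
          gcongr
      _ = Cd * Real.exp (2 * c * C) * D * Real.exp (-c * |(b.val : ℝ) - a.val|) := by ring
  calc ∑ a, ∑ b, |∫ z, f a z * f b z ∂μ|
      ≤ ∑ a : Fin N, ∑ b : Fin N,
          Cd * Real.exp (2 * c * C) * D * Real.exp (-c * |(b.val : ℝ) - a.val|) :=
        Finset.sum_le_sum fun a _ => Finset.sum_le_sum fun b _ => hab a b
    _ = ∑ a : Fin N, Cd * Real.exp (2 * c * C) * D *
          ∑ b : Fin N, Real.exp (-c * |(b.val : ℝ) - a.val|) := by
        simp_rw [Finset.mul_sum]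
    _ ≤ ∑ _a : Fin N, Cd * Real.exp (2 * c * C) * D * ∑' k : ℤ, Real.exp (-c * |(k : ℝ)|) := by
        gcongr with a
        exact sum_exp_neg_mul_abs_le hc N a
    _ = N * (Cd * Real.exp (2 * c * C) * D * ∑' k : ℤ, Real.exp (-c * |(k : ℝ)|)) := by
        rw [Finset.sum_const, Finset.card_univ, Fintype.card_fin, nsmul_eq_mul]

/-- Integrating the decomposition `ε J_{a,a+1} = L_H U_a + κ G_a` along the flow and summing over
the bonds: `ε ∫₀^τ 𝒥_N(X^s z) ds = 𝒰(X^τ z) - 𝒰(z) + κ ∫₀^τ 𝒢(X^s z) ds` with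
`𝒰 = N^{-1/2} ∑ₐ U_a`, `𝒢 = N^{-1/2} ∑ₐ G_a`. [cite: DeRoeckHuveneers2015, §7 proof of Thm 2] -/
theorem IsFlow.integral_totalCurrent_eq {ε γ : ℝ} {Φ : ℝ → PhaseSpace N → PhaseSpace N}
    (hΦ : IsFlow N ε γ Φ) {U G : Fin N → PhaseSpace N → ℝ} {n : WithTop ℕ∞} (hn : n ≠ 0)
    (hU : ∀ a, ContDiff ℝ n (U a)) (hG : ∀ a, Continuous (G a)) {κ : ℝ}
    (hdec : ∀ a z, ε * bondCurrent N a z = liouville N ε γ (U a) z + κ * G a z)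
    (z : PhaseSpace N) (τ : ℝ) :
    ε * ∫ s in (0:ℝ)..τ, totalCurrent N (Φ s z) =
      (∑ a, U a (Φ τ z)) / Real.sqrt N - (∑ a, U a z) / Real.sqrt N +
        κ * ∫ s in (0:ℝ)..τ, (∑ a, G a (Φ s z)) / Real.sqrt N := by
  have hc : Continuous fun s : ℝ => Φ s z := hΦ.1.comp (continuous_id.prodMk continuous_const)
  have hiG : ∀ a, IntervalIntegrable (fun s => G a (Φ s z)) volume 0 τ := fun a =>
    ((hG a).comp hc).intervalIntegrable _ _
  have hbond : ∀ a, ε * ∫ s in (0:ℝ)..τ, bondCurrent N a (Φ s z) =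
      U a (Φ τ z) - U a z + κ * ∫ s in (0:ℝ)..τ, G a (Φ s z) := by
    intro a
    have hiL : IntervalIntegrable (fun s => liouville N ε γ (U a) (Φ s z)) volume 0 τ :=
      ((continuous_liouville ε γ (hU a) hn).comp hc).intervalIntegrable _ _
    rw [← intervalIntegral.integral_const_mul]
    simp_rw [hdec a]
    rw [intervalIntegral.integral_add hiL ((hiG a).const_mul κ), intervalIntegral.integral_const_mul,
      hΦ.integral_liouville (hU a) hn z 0 τ, hΦ.2.1 z]
  have hiJ : ∀ a, IntervalIntegrable (fun s => bondCurrent N a (Φ s z)) volume 0 τ := fun a =>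
    ((continuous_bondCurrent a).comp hc).intervalIntegrable _ _
  unfold totalCurrent
  rw [intervalIntegral.integral_div, intervalIntegral.integral_finsetSum fun a _ => hiJ a,
    intervalIntegral.integral_div, intervalIntegral.integral_finsetSum fun a _ => hiG a,
    mul_div_assoc', Finset.mul_sum]
  simp_rw [hbond]
  rw [Finset.sum_add_distrib, Finset.sum_sub_distrib, ← Finset.mul_sum]
  ring

/-- `(∑ₐ fₐ)²` is integrable when the `fₐ` are in `L²`. [folklore] -/
theorem integrable_sq_sum {X : Type*} [MeasurableSpace X] (μ : Measure X) {ι : Type*} [Fintype ι]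
    (f : ι → X → ℝ) (hf : ∀ a, MemLp (f a) 2 μ) :
    Integrable (fun z => (∑ a, f a z) ^ 2) μ := by
  have e : (fun z => (∑ a, f a z) ^ 2) = fun z => ∑ a, ∑ b, f a z * f b z := by
    funext z; rw [sq, Finset.sum_mul_sum]
  rw [e]
  exact integrable_finsetSum _ fun a _ => integrable_finsetSum _ fun b _ =>
    (hf a).integrable_mul (hf b)

end Literature.Barriers.AtomisticToContinuum.HeatConduction.RotorChain

end
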